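import Literature.Analysis.FluidPDE.LeiZhang2011StreamLimit
import HarnessLib

/-!
# Lei–Zhang 2011, Theorem 1.4: the `BMO` stream bound survives the blow-up limit
# (endgame for locally uniform limits)

Analysis/FluidPDE **proofs file** (theorems only: no definitions, no named facts, no `sorry`) on
the discharge path of the named fact
`Literature.Analysis.FluidPDE.LeiZhang2011_regularity_bmoStream` (Z. Lei, Q. S. Zhang,
J. Funct. Anal. 261 (2011) 2323–2345 = arXiv:1011.5066, **Theorem 1.4**, proof §4 pp. 12–13),
fourth file, built on the scale-invariant pairing estimate of `LeiZhang2011StreamLimit.lean`.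

In both cases of the printed proof the blow-up limit `u` of the rescaled solutions
`v^{(k)}(x, t) = Q_k⁻¹ v(x_k + x/Q_k, t_k + t/Q_k²)` ("`→ u` in `L^∞(Ω)` for any compact `Ω`",
p. 13) is constant in space at a.e. time — `(0, 0, l(t))` by Theorem 1.1 and KNSS Thm. 5.2 in
Case 1, `u^r(t) ν + u^z(t) e_z` by `(ν⊥·∇)u = 0` and KNSS Thm. 5.1 in Case 2 — and "the
boundedness of the stream function of `u` in BMO norm implies that `u = 0`" (p. 13). Here:

* `tendsto_integral_ballCutoff_mul_inner` — the pairings `∫ φ_R ⟪w_k, e⟫` pass to uniform limits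
  on `B̄(x₀, 3R)`;
* `eq_zero_of_forall_abs_integral_ballCutoff_mul_inner_le` — an a.e.-constant field whose
  pairings with the plateaux are `O(R²)` vanishes (`‖c‖² |B̄(0,2R)| ≤ M ‖c‖ R²` for all `R`);
* `eq_zero_of_tendstoUniformlyOn_of_bmoStream`, `ae_eq_zero_of_tendstoUniformlyOn_of_bmoStream`
  — **the assembled endgame for blow-up limits**: a locally uniform limit of fields with
  uniformly `BMO`-bounded differentiable stream functions which is a.e. constant is zero. No
  compactness in `BMO` and no stream function of the limit are needed.

What is *not* here (and keeps the fact open, size XL): Theorem 1.1 of the paper, the blow-up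
procedure itself (extraction of the locally uniformly convergent rescaled sequence at a first
axis singular point, KNSS §4/Lemma 6.1), and the identification of the limit as constant in
space (Thm. 1.1 + KNSS Thm. 5.2 in Case 1; the bound on `Γ`, `(ν⊥·∇)u = 0` and KNSS Thm. 5.1
in Case 2).

## Mathlib / tree search

Reused: `exists_abs_integral_ballCutoff_mul_inner_le` (`LeiZhang2011StreamLimit`); `ballCutoff`,
`ballCutoff_eq_one`, `ballCutoff_nonneg`, `abs_ballCutoff_le_one`, `ballCutoff_eventuallyEq_zero`,
`contDiff_ballCutoff`, `hasCompactSupport_ballCutoff` (`BallCutoff`); Mathlib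
`Metric.tendstoUniformlyOn_iff`, `norm_integral_le_of_norm_le`, `Measure.addHaar_closedBall`,
`le_of_tendsto'`. `lean search 'TendstoUniformlyOn.*BMO|bmoStream'`: nothing prior besides the
files above.

## References

* Z. Lei, Q. S. Zhang, *A Liouville theorem for the axially-symmetric Navier–Stokes equations*,
  J. Funct. Anal. 261 (2011) 2323–2345 = arXiv:1011.5066: Thm. 1.4 (p. 4), proof §4, Cases 1–2
  (pp. 12–13). [LeiZhang2011]
* G. Koch, N. Nadirashvili, G. Seregin, V. Šverák, Acta Math. 203 (2009) 83–105, Thms. 5.1–5.2,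
  §6. [KochNadirashviliSereginSverak2009]
-/

noncomputable section

open MeasureTheory Set Function Filter Topology TopologicalSpace Metric
open scoped InnerProductSpace RealInnerProductSpace NNReal ENNReal

namespace Literature.Analysis.FluidPDE

open Literature.Analysis.FunctionSpaces

/-! ### Passing to the limit along a blow-up sequence -/

/-- **Pairings with `φ_R` pass to locally uniform limits.** If `w_k → w` uniformly on
`B̄(x₀, 3R)` (all fields locally integrable), then `∫ φ_R ⟪w_k, e⟫ → ∫ φ_R ⟪w, e⟫`
(`φ_R = ballCutoff x₀ R` vanishes off `B̄(x₀, 3R)` and `|φ_R| ≤ 1`). In the printed proof the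
rescaled solutions converge to the ancient solution "in `L^∞(Ω)` for any compact subset `Ω`"
(arXiv:1011.5066 p. 13). [cite: LeiZhang2011, Thm. 1.4, proof §4 (arXiv p. 13)] -/
theorem tendsto_integral_ballCutoff_mul_inner
    {w : ℕ → EuclideanSpace ℝ (Fin 3) → EuclideanSpace ℝ (Fin 3)}
    {u : EuclideanSpace ℝ (Fin 3) → EuclideanSpace ℝ (Fin 3)} {x₀ : EuclideanSpace ℝ (Fin 3)}
    {R : ℝ} (hR : 0 < R) (hw : ∀ k, LocallyIntegrable (w k) volume)
    (hu : LocallyIntegrable u volume)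
    (hconv : TendstoUniformlyOn w u atTop (closedBall x₀ (3 * R))) (e : EuclideanSpace ℝ (Fin 3)) :
    Tendsto (fun k => ∫ x, ballCutoff x₀ R x * ⟪w k x, e⟫) atTop
      (𝓝 (∫ x, ballCutoff x₀ R x * ⟪u x, e⟫)) := by
  set φ : EuclideanSpace ℝ (Fin 3) → ℝ := ballCutoff x₀ R with hφ
  have hφc : Continuous φ := (contDiff_ballCutoff x₀ R (n := 0)).continuous
  have hφs : HasCompactSupport φ := hasCompactSupport_ballCutoff hR
  have hφ0 : ∀ x, x ∉ closedBall x₀ (3 * R) → φ x = 0 := fun x hx =>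
    (ballCutoff_eventuallyEq_zero hR hx).self_of_nhds
  -- integrability of the pairings
  have hint : ∀ v : EuclideanSpace ℝ (Fin 3) → EuclideanSpace ℝ (Fin 3),
      LocallyIntegrable v volume → Integrable (fun x => φ x * ⟪v x, e⟫) := fun v hv => by
    have := (hv.integrable_smul_left_of_hasCompactSupport hφc hφs).inner_const (𝕜 := ℝ) e
    refine this.congr (Eventually.of_forall fun x => ?_)
    simp only [real_inner_smul_left]
  set V : ℝ := volume.real (closedBall x₀ (3 * R)) with hV
  rw [Metric.tendsto_atTop]
  intro ε hε
  -- uniform closeness on the closed ball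
  obtain ⟨δ, hδ, hδε⟩ : ∃ δ : ℝ, 0 < δ ∧ δ * (‖e‖ * V) < ε := by
    refine ⟨ε / (‖e‖ * V + 1), div_pos hε (by positivity), ?_⟩
    rw [div_mul_eq_mul_div, div_lt_iff₀ (by positivity)]
    nlinarith [norm_nonneg e, (measureReal_nonneg : 0 ≤ V)]
  obtain ⟨N, hN⟩ := eventually_atTop.1 ((Metric.tendstoUniformlyOn_iff.1 hconv) δ hδ)
  refine ⟨N, fun k hk => ?_⟩
  rw [dist_eq_norm, ← integral_sub (hint _ (hw k)) (hint _ hu)]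
  have hpt : ∀ x, φ x * ⟪w k x, e⟫ - φ x * ⟪u x, e⟫ = φ x * ⟪w k x - u x, e⟫ := fun x => by
    rw [inner_sub_left, mul_sub]
  simp_rw [hpt]
  -- pointwise bound by `δ ‖e‖` times the indicator of the closed ball
  have hbound : ∀ x, ‖φ x * ⟪w k x - u x, e⟫‖ ≤
      (closedBall x₀ (3 * R)).indicator (fun _ => δ * ‖e‖) x := by
    intro x
    by_cases hx : x ∈ closedBall x₀ (3 * R)
    · rw [indicator_of_mem hx, norm_mul, Real.norm_eq_abs]
      have h1 : |φ x| ≤ 1 := abs_ballCutoff_le_one x₀ R x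
      have h2 : ‖w k x - u x‖ ≤ δ := by
        rw [← dist_eq_norm, dist_comm]; exact (hN k hk x hx).le
      calc |φ x| * ‖⟪w k x - u x, e⟫‖ ≤ 1 * (‖w k x - u x‖ * ‖e‖) := by
            gcongr; exact norm_inner_le_norm _ _
        _ ≤ 1 * (δ * ‖e‖) := by gcongr
        _ = δ * ‖e‖ := one_mul _
    · rw [indicator_of_notMem hx, hφ0 x hx]
      simp
  calc ‖∫ x, φ x * ⟪w k x - u x, e⟫‖
      ≤ ∫ x, (closedBall x₀ (3 * R)).indicator (fun _ => δ * ‖e‖) x :=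
        norm_integral_le_of_norm_le
          ((integrableOn_const (measure_closedBall_lt_top).ne).integrable_indicator
            measurableSet_closedBall) (Eventually.of_forall hbound)
    _ = δ * (‖e‖ * V) := by
        rw [integral_indicator measurableSet_closedBall, setIntegral_const, smul_eq_mul, hV]; ring
    _ < ε := hδε

/-- **An a.e.-constant field whose pairings with the plateaux `φ_R` are `O(R²)` vanishes.** If
`w = c` a.e. and `|∫ φ_R ⟪w, e⟫| ≤ M ‖e‖ R²` for all `R > 0` and `e` (`φ_R = ballCutoff 0 R`),
then `c = 0`: with `e = c`, `‖c‖² |B̄(0, 2R)| ≤ ∫ φ_R ‖c‖² ≤ M ‖c‖ R²`, i.e. `8 R |B(0,1)| ‖c‖ ≤ M`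
for every `R`. [cite: LeiZhang2011, Thm. 1.4, proof §4, Cases 1–2 (arXiv pp. 12–13)] -/
theorem eq_zero_of_forall_abs_integral_ballCutoff_mul_inner_le
    {w : EuclideanSpace ℝ (Fin 3) → EuclideanSpace ℝ (Fin 3)} {c : EuclideanSpace ℝ (Fin 3)}
    (hw : w =ᵐ[volume] fun _ => c) {M : ℝ}
    (h : ∀ R : ℝ, 0 < R → ∀ e : EuclideanSpace ℝ (Fin 3),
      |∫ x, ballCutoff 0 R x * ⟪w x, e⟫| ≤ M * ‖e‖ * R ^ 2) :
    c = 0 := by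
  set V : ℝ := volume.real (ball (0 : EuclideanSpace ℝ (Fin 3)) 1) with hV
  have hVpos : 0 < V :=
    ENNReal.toReal_pos (measure_ball_pos volume _ one_pos).ne' measure_ball_lt_top.ne
  -- the lower bound `‖c‖² (2R)³ V ≤ M ‖c‖ R²`
  have key : ∀ R : ℝ, 0 < R → ‖c‖ ^ 2 * ((2 * R) ^ 3 * V) ≤ M * ‖c‖ * R ^ 2 := by
    intro R hR
    set φ : EuclideanSpace ℝ (Fin 3) → ℝ := ballCutoff 0 R with hφ
    have hφc : Continuous φ := (contDiff_ballCutoff 0 R (n := 0)).continuous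
    have hφs : HasCompactSupport φ := hasCompactSupport_ballCutoff hR
    have hφi : Integrable φ := hφc.integrable_of_hasCompactSupport hφs
    have h2R : 0 ≤ 2 * R := by linarith
    -- `∫ φ ≥ |B̄(0, 2R)| = (2R)³ V`
    have hlow : (2 * R) ^ 3 * V ≤ ∫ x, φ x := by
      have hvol :
          volume.real (closedBall (0 : EuclideanSpace ℝ (Fin 3)) (2 * R)) = (2 * R) ^ 3 * V := by
        simp only [hV, Measure.real]
        rw [Measure.addHaar_closedBall volume _ h2R, finrank_euclideanSpace_fin, ENNReal.toReal_mul,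
          ENNReal.toReal_ofReal (pow_nonneg h2R 3)]
      have hind : ∫ x, (closedBall (0 : EuclideanSpace ℝ (Fin 3)) (2 * R)).indicator
          (fun _ => (1 : ℝ)) x =
            volume.real (closedBall (0 : EuclideanSpace ℝ (Fin 3)) (2 * R)) := by
        rw [integral_indicator measurableSet_closedBall, setIntegral_const, smul_eq_mul, mul_one]
      rw [← hvol, ← hind]
      refine integral_mono ((integrableOn_const measure_closedBall_lt_top.ne).integrable_indicator
        measurableSet_closedBall) hφi fun x => ?_
      by_cases hx : x ∈ closedBall (0 : EuclideanSpace ℝ (Fin 3)) (2 * R)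
      · rw [indicator_of_mem hx, hφ, ballCutoff_eq_one hR (by simpa using hx)]
      · rw [indicator_of_notMem hx]; exact ballCutoff_nonneg 0 R x
    -- `∫ φ ⟪w, c⟫ = ‖c‖² ∫ φ`
    have heq : ∫ x, φ x * ⟪w x, c⟫ = ‖c‖ ^ 2 * ∫ x, φ x := by
      rw [← integral_const_mul]
      refine integral_congr_ae ?_
      filter_upwards [hw] with x hx
      rw [hx, real_inner_self_eq_norm_sq]; ring
    have h1 := h R hR c
    have hI0 : (0 : ℝ) ≤ ∫ x, φ x := (by positivity : (0:ℝ) ≤ (2 * R) ^ 3 * V).trans hlow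
    rw [heq, abs_of_nonneg (mul_nonneg (sq_nonneg _) hI0)] at h1
    calc ‖c‖ ^ 2 * ((2 * R) ^ 3 * V) ≤ ‖c‖ ^ 2 * ∫ x, φ x := by gcongr
      _ ≤ M * ‖c‖ * R ^ 2 := h1
  -- conclude
  by_contra hc
  have hcpos : 0 < ‖c‖ := norm_pos_iff.2 hc
  set R : ℝ := (|M| + 1) / (8 * V * ‖c‖) with hR
  have hRpos : 0 < R := by positivity
  have h := key R hRpos
  -- `‖c‖² 8 R³ V ≤ M ‖c‖ R²` gives `8 V ‖c‖ R ≤ M`, but `8 V ‖c‖ R = |M| + 1`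
  have h2 : 8 * V * ‖c‖ * R ≤ M := by
    have hR2 : 0 < ‖c‖ * R ^ 2 := by positivity
    have : 8 * V * ‖c‖ * R * (‖c‖ * R ^ 2) ≤ M * (‖c‖ * R ^ 2) := by
      calc 8 * V * ‖c‖ * R * (‖c‖ * R ^ 2) = ‖c‖ ^ 2 * ((2 * R) ^ 3 * V) := by ring
        _ ≤ M * ‖c‖ * R ^ 2 := h
        _ = M * (‖c‖ * R ^ 2) := by ring
    exact le_of_mul_le_mul_right this hR2
  have h3 : 8 * V * ‖c‖ * R = |M| + 1 := by
    rw [hR]; field_simp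
  rw [h3] at h2
  linarith [le_abs_self M]

/-- **A locally uniform limit of fields with uniformly `BMO`-bounded stream functions that is
constant in space vanishes** (the endgame of both cases of the proof of Theorem 1.4 applied to the
blow-up limit). Let `w_k : ℝ³ → ℝ³` have differentiable stream functions `B_k`,
`curl B_k = w_k` a.e., with a uniform bound `‖B_k‖_{BMO} ≤ K` (as the rescalings
`Q_k⁻¹ v(x_k + ·/Q_k, t_k + t/Q_k²)` of a solution with an `L^∞_t BMO_x` stream function do, at
each fixed rescaled time), and let `w_k → u` uniformly on every ball. If `u = c` a.e. for a
constant vector `c` (the output of KNSS Thm. 5.2 in Case 1 and of KNSS Thm. 5.1 in Case 2), then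
`c = 0`: the pairings `∫ φ_R ⟪w_k, e⟫` are `O(K R²)` uniformly in `k`
(`exists_abs_integral_ballCutoff_mul_inner_le`), pass to the limit
(`tendsto_integral_ballCutoff_mul_inner`), and an a.e.-constant field with `O(R²)` pairings is
zero (`eq_zero_of_forall_abs_integral_ballCutoff_mul_inner_le`). No compactness in `BMO` and no
stream function of the limit are needed.
[cite: LeiZhang2011, Thm. 1.4, proof §4, Cases 1–2 (arXiv pp. 12–13)] -/
theorem eq_zero_of_tendstoUniformlyOn_of_bmoStream
    {B w : ℕ → EuclideanSpace ℝ (Fin 3) → EuclideanSpace ℝ (Fin 3)}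
    {u : EuclideanSpace ℝ (Fin 3) → EuclideanSpace ℝ (Fin 3)} {c : EuclideanSpace ℝ (Fin 3)}
    {K : ℝ≥0} (hB : ∀ k, Differentiable ℝ (B k)) (hcurl : ∀ k, curl (B k) =ᵐ[volume] w k)
    (hbmo : ∀ k, eBMOSeminormVec (B k) ≤ K) (hw : ∀ k, LocallyIntegrable (w k) volume)
    (hu : LocallyIntegrable u volume)
    (hconv : ∀ r : ℝ, 0 < r →
      TendstoUniformlyOn w u atTop (closedBall (0 : EuclideanSpace ℝ (Fin 3)) r))
    (huc : u =ᵐ[volume] fun _ => c) : c = 0 := by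
  obtain ⟨A, -, h⟩ := exists_abs_integral_ballCutoff_mul_inner_le
  refine eq_zero_of_forall_abs_integral_ballCutoff_mul_inner_le huc (M := A * K)
    fun R hR e => ?_
  have hlim := tendsto_integral_ballCutoff_mul_inner hR hw hu (hconv (3 * R) (by positivity)) e
  have hbd : ∀ k, |∫ x, ballCutoff 0 R x * ⟪w k x, e⟫| ≤ A * K * ‖e‖ * R ^ 2 := fun k =>
    h (B k) (w k) (hB k) (hcurl k) (hw k) K (hbmo k) 0 R hR e
  exact le_of_tendsto' hlim.abs hbd

/-- The same with the limit known to be a.e. constant only through a representative: if moreover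
`u` is a.e. equal to `fun _ => c`, then `u = 0` a.e.
[cite: LeiZhang2011, Thm. 1.4, proof §4, Cases 1–2 (arXiv pp. 12–13)] -/
theorem ae_eq_zero_of_tendstoUniformlyOn_of_bmoStream
    {B w : ℕ → EuclideanSpace ℝ (Fin 3) → EuclideanSpace ℝ (Fin 3)}
    {u : EuclideanSpace ℝ (Fin 3) → EuclideanSpace ℝ (Fin 3)} {c : EuclideanSpace ℝ (Fin 3)}
    {K : ℝ≥0} (hB : ∀ k, Differentiable ℝ (B k)) (hcurl : ∀ k, curl (B k) =ᵐ[volume] w k)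
    (hbmo : ∀ k, eBMOSeminormVec (B k) ≤ K) (hw : ∀ k, LocallyIntegrable (w k) volume)
    (hu : LocallyIntegrable u volume)
    (hconv : ∀ r : ℝ, 0 < r →
      TendstoUniformlyOn w u atTop (closedBall (0 : EuclideanSpace ℝ (Fin 3)) r))
    (huc : u =ᵐ[volume] fun _ => c) : u =ᵐ[volume] 0 := by
  have hc := eq_zero_of_tendstoUniformlyOn_of_bmoStream hB hcurl hbmo hw hu hconv huc
  subst hc
  exact huc

end Literature.Analysis.FluidPDE
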